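import Summits.HodgeConjecture.HodgeConjecture.Theorems.F0P2oYCoinvariantsChartCM            -- ★ p835408 (E1-CM): the chart `(Γ, Ψ, s′, φ₀)` of the CM closer
import Literature.RepresentationTheory.HeisenbergGroup.SchrodingerBoxFibreFactorisation     -- (BE) generic: `exists_fibre_boxSB_eq_smul`
import Literature.NumberTheory.GelbartRogawski1991.LocalUnitaryBlockRestriction             -- ★ `BlockSum.localGram_finSum`
import HarnessLib

/-!
# Crux `H413`, programme P2, N3 road (a)-block, brick (BE) — THE (E1-CM) CHART FACTORISES IN THE BLOCK FRAME

Cell hodgecm-mathlib (D-0151), FLOOR 0, crux item H413 = stmt-HodgeConjecture-24833, programme P2; N3 road v3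
(`F0/P2/B-p18/g29/N3-ROAD.v3.B-p18g29.md`), (a)-block, brick (BE) (lead B-p18 (g29), fuse 2026-08-31T23:27:34Z).  THEOREMS ONLY (no `def`,
no instance, no notation, no named fact, no `sorry`); never imports a `Cruxes/…/Lines` module; kernel lane `--supports stmt-HodgeConjecture-24833
--as helper`.  HC_CM is proved only modulo the printed citations until rung 0 closes; nothing printed is asserted here.

WHAT.  ★ p835408 `F0P2oYCoinvariantsChartCM.exists_chart_of_nonsplit` charts `r_N(ω_v ∘ ch)` at a non-split place: a symplectic chart `Γ` of
`𝕎_v = F³ × F³` onto the dot model `F^{Fin 2 ⊔ Fin 1} × F^{Fin 2 ⊔ Fin 1}` ((i): built from `h(x₀, ·)`, `h(y₀, ·)` — the `Fin 2`-slot — and `h(b, ·)` — the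
`Fin 1`-slot), an intertwiner `Ψ` of Schrödinger models along the conjugation coboundary of `Γ` ((ii)), and the fibre map `φ₀` ((v)) with
`Coinvariants.ker = Ψ⁻¹(ker φ₀)` ((vi)).  AT A BLOCK FRAME — the pair enumerated by `e₁ = Equiv.prodUnique (Fin 3) (Fin 1)`, the real Gram matrix a block
sum `T₁ ⊕ᶠ T₂` (`hTsum`, line `⊕` plane), and a form congruence `T₀` whose isotropic frame vectors `x₀ = T₀.col 0`, `y₀ = u⁻¹ T₀.col 2` have NO line
component (`T₀ 0 0 = 0 = T₀ 0 2`; ★ p837182 `F0P2oBlockAdaptedCongruence.exists_blockAdaptedCongr` gives `T₀ = (0,x) ∣ (1,0,0) ∣ (0,xs)`) — the chart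
sends the line summand `W_{T₁}` of `𝕎_v` into the `Fin 1`-slot ((C1) `hsupp`, since `h(x₀, v) = 0 = h(y₀, v)` for a line-slot vector `v`: the Gram
matrix is diagonal by (0)).  Hence the generic ★ `exists_fibre_boxSB_eq_smul` applies:

`exists_fibre_boxSB_eq_smul_blockFrame` — there are a symplectic line chart `Γ₁` of `W_{T₁} = F × F`, an intertwiner `Ψ₁ : 𝒮(F) ≃ 𝒮(F)` of
`ρ_{T₁,v} = localSchrodinger L⁺ 1 T₁ v` with the dot model along the coboundary of `Γ₁`, and for every plane test function `f_p ∈ 𝒮(F²)` a scalar `c`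
with `φ₀ (Ψ (f_l ⊠ f_p)) = c • Ψ₁ f_l` for all `f_l ∈ 𝒮(F)` (`⊠ = boxSB F finSumFinEquiv`, the box of ★ `DoubledBlock.toRep_localSplittingCMWith_inlLoc_boxSB`).

USE ((C5), (N′) at the block frame).  `π̄ := φ₀ ∘ Ψ` is the Jacquet quotient `r_N(ω_v ∘ ch) ≅ 𝒮(F)` ((v)(vi)); by the local see-saw ★ p836839 the torus
`d(1, β, 1)` acts on a box by `ω₁(s₁ β) f_l ⊠ f_p`, so on `r_N ≅_{Ψ₁⁻¹ ∘ π̄} 𝒮(F)` by the rank-one Weil operator `ω₁(s₁ β)` — boxes span (★ `linearMap_ext_boxSB`).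
[Kudla1986, Thm. 2.8; MoeglinVignerasWaldspurger1987, Chap. 2 I.3, II.1 (A), Chap. 3 §IV.2; GelbartRogawski1991, §3.2 (3.2.3) p. 457.]

## References
* [MoeglinVignerasWaldspurger1987] C. Mœglin, M.-F. Vignéras, J.-L. Waldspurger, LNM 1291 (1987): Chap. 2 I.3, II.1 (A); Chap. 3 §IV.2.
* [Kudla1986] S. Kudla, *On the local theta-correspondence*, Invent. Math. 83 (1986): Thm. 2.8.
* [Kudla1984] S. Kudla, *Seesaw dual reductive pairs*, Progr. Math. 46 (1984): §1.
* [GelbartRogawski1991] S. Gelbart, J. Rogawski, Invent. Math. 105 (1991): §3.2 (3.2.3) p. 457.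
-/

set_option autoImplicit false
set_option linter.dupNamespace false -- the mandated namespace repeats the single-problem summit's segment

noncomputable section

open scoped MatrixGroups Kronecker
open _root_.Matrix NumberField IsDedekindDomain
open Literature.NumberTheory.Automorphic Literature.NumberTheory.Automorphic.UnitaryGroup
open Literature.NumberTheory.Automorphic.UnitaryGroup.QuadraticCoordinates Literature.NumberTheory.Automorphic.UnitaryGroup.IsQuadraticCoordinates
open Literature.NumberTheory.Automorphic.Liu2021 Literature.NumberTheory.Automorphic.Liu2021.Def411WeilCarriers
open Literature.NumberTheory.GelbartRogawski1991 Literature.NumberTheory.GelbartRogawski1991.UnitaryDualPair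
open Literature.NumberTheory.GelbartRogawski1991.UnitaryDualPair.LocalSplitting
open Literature.RepresentationTheory Literature.RepresentationTheory.HeisenbergGroup

namespace Summit.HodgeConjecture.HodgeConjecture.Cruxes.H413.F0P2oBlockFrameChartFactorisation

/-! ## §1 A hermitian form value vanishes on a vector supported where the other vector and the Gram column vanish -/

/-- `h(x, y) = Σ_k σ(x_k) (H y)_k = 0` when `y` is supported on one coordinate `k₀`, the column `H · k₀` vanishes off `k₀`, and `x_{k₀} = 0`.
[cite: MoeglinVignerasWaldspurger1987, Chap. 3 §IV.2] -/
theorem hermForm_eq_zero_of_support {S : Type*} [CommRing S] {n : Type*} [Fintype n] [DecidableEq n] (σ : S →+* S)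
    (H : Matrix n n S) (x y : n → S) (k₀ : n) (hy : ∀ k, k ≠ k₀ → y k = 0) (hH : ∀ k, k ≠ k₀ → H k k₀ = 0) (hx : x k₀ = 0) :
    hermForm σ H x y = 0 := by
  have hmv : H *ᵥ y = fun k => H k k₀ * y k₀ := funext fun k =>
    Finset.sum_eq_single k₀ (fun l _ hl => by rw [hy l hl, mul_zero]) (fun h => absurd (Finset.mem_univ k₀) h)
  rw [hermForm_apply, hmv, dotProduct]
  refine Finset.sum_eq_zero fun k _ => ?_
  by_cases hk : k = k₀
  · rw [hk, Function.comp_apply, hx, map_zero, zero_mul]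
  · rw [hH k hk, zero_mul, mul_zero]

/-! ## §2 The factorisation at a block frame -/

section BlockFrame

variable (L : Type) [Field L] [NumberField L] [IsCMField L]

set_option synthInstance.maxHeartbeats 400000 in
set_option maxHeartbeats 8000000 in
/-- **(BE) THE (E1-CM) CHART FACTORISES IN THE BLOCK FRAME.**  For a CM field `L`, a real non-zero diagonal `dV`, a W-unit `ε`, a finite place `v` of `L⁺`,
a block decomposition `hTsum : gram e_std (diag dV) (ε) = T₁ ⊕ᶠ T₂` of the real Gram matrix (`e_std = Equiv.prodUnique (Fin 3) (Fin 1)`, `det T₁` a unit),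
a form congruence matrix `T₀` with `T₀ 0 0 = 0 = T₀ 0 2` (no line component in the isotropic frame vectors), and ANY data `(u, a₀, Γ, Ψ, φ₀)` with the
conjuncts (0), (i), (i-symplectic), (ii), (v) of ★ `F0P2oYCoinvariantsChartCM.exists_chart_of_nonsplit` (binders VERBATIM at `e₁ = e_std`, `n′ = 3`, `T = T₀`):
there are a symplectic `Γ₁ : F × F ≃ F^{Fin 1} × F^{Fin 1}` with `Γ (a ⊔ 0, b ⊔ 0) = (0 ⊔ (Γ₁(a,b)).1, 0 ⊔ (Γ₁(a,b)).2)`, an intertwiner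
`Ψ₁ : 𝒮(F) ≃ₗ[ℂ] 𝒮(F^{Fin 1})` of `localSchrodinger L⁺ 1 T₁ v` with the dot model along the coboundary of `Γ₁`, and for every `f_p ∈ 𝒮(F²)` a scalar `c`
with `φ₀ (Ψ (boxSB F finSumFinEquiv f_l f_p)) = c • Ψ₁ f_l` for all `f_l`.  Proof: (C1) the chart sends the line summand into the `Fin 1`-slot (§1 with the
diagonal Gram matrix of (0)), then ★ `exists_fibre_boxSB_eq_smul` with `hT` = `hTsum` + ★ `BlockSum.localGram_finSum`.
[cite: Kudla1986, Thm. 2.8] [cite: MoeglinVignerasWaldspurger1987, Chap. 2 I.3, II.1 (A); Chap. 3 §IV.2] [cite: Kudla1984, §1] [cite: GelbartRogawski1991, §3.2 (3.2.3) p. 457] -/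
theorem exists_fibre_boxSB_eq_smul_blockFrame (dV : Fin 3 → L) (hdV : ∀ i, IsCMField.complexConj L (dV i) = dV i)
    (ε : (↥(maximalRealSubfield L))ˣ) (v : HeightOneSpectrum (𝓞 ↥(maximalRealSubfield L)))
    (T₁ : Matrix (Fin 1) (Fin 1) ↥(maximalRealSubfield L)) (T₂ : Matrix (Fin 2) (Fin 2) ↥(maximalRealSubfield L)) (hT₁ : IsUnit T₁.det)
    (hTsum : gram (↥(maximalRealSubfield L)) (Equiv.prodUnique (Fin 3) (Fin 1)) (realDiagonal L dV hdV) (TW (↥(maximalRealSubfield L)) ε) =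
      UnitaryGroup.finSum 1 2 T₁ T₂)
    (T₀ : GL (Fin 3) (UnitaryGroup.LocalRing L v)) (h00 : (T₀ : Matrix (Fin 3) (Fin 3) (UnitaryGroup.LocalRing L v)) 0 0 = 0)
    (h02 : (T₀ : Matrix (Fin 3) (Fin 3) (UnitaryGroup.LocalRing L v)) 0 2 = 0)
    (u : (UnitaryGroup.LocalRing L v)ˣ) (a₀ : v.adicCompletion ↥(maximalRealSubfield L))
    (Γ : ((Fin 3 → (v.adicCompletion ↥(maximalRealSubfield L))) × (Fin 3 → (v.adicCompletion ↥(maximalRealSubfield L)))) ≃ₗ[(v.adicCompletion ↥(maximalRealSubfield L))] (((Fin 2 ⊕ Fin 1) → (v.adicCompletion ↥(maximalRealSubfield L))) × ((Fin 2 ⊕ Fin 1) → (v.adicCompletion ↥(maximalRealSubfield L)))))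
    (Ψ : SchwartzBruhat (Fin 3 → (v.adicCompletion ↥(maximalRealSubfield L))) ≃ₗ[ℂ] SchwartzBruhat ((Fin 2 ⊕ Fin 1) → (v.adicCompletion ↥(maximalRealSubfield L))))
    (φ₀ : SchwartzBruhat ((Fin 2 ⊕ Fin 1) → (v.adicCompletion ↥(maximalRealSubfield L))) →ₗ[ℂ] SchwartzBruhat (Fin 1 → (v.adicCompletion ↥(maximalRealSubfield L))))
    -- (0) the pair form on `S³`
    (h0 : ((localGram (↥(maximalRealSubfield L)) 3 (gram (↥(maximalRealSubfield L)) (Equiv.prodUnique (Fin 3) (Fin 1)) (realDiagonal L dV hdV) (TW (↥(maximalRealSubfield L)) ε)) v).map (toLocalRing L v)) = Matrix.reindex (Equiv.prodUnique (Fin 3) (Fin 1)) (Equiv.prodUnique (Fin 3) (Fin 1)) (((Matrix.diagonal dV).map (algebraMap L (UnitaryGroup.LocalRing L v))) ⊗ₖ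
        ((JW (↥(maximalRealSubfield L)) L ε).map (algebraMap L (UnitaryGroup.LocalRing L v)))))
    -- (i) the chart formula at `T = T₀`
    (hi : ∀ x : Fin 3 → UnitaryGroup.LocalRing L v, Γ (reIm (quadraticLocalEquiv L v (IsCMField.complexConj L) (complexConj_imagUnit L) (imagUnit_ne_zero L)).toLinearEquiv.toAddEquiv (Fin 3) x) =
        (Sum.elim ![re (quadraticLocalEquiv L v (IsCMField.complexConj L) (complexConj_imagUnit L) (imagUnit_ne_zero L)).toLinearEquiv.toAddEquiv (hermForm (conjLocal L (IsCMField.complexConj L) v) ((localGram (↥(maximalRealSubfield L)) 3 (gram (↥(maximalRealSubfield L)) (Equiv.prodUnique (Fin 3) (Fin 1)) (realDiagonal L dV hdV) (TW (↥(maximalRealSubfield L)) ε)) v).map (toLocalRing L v)) (fun k => (T₀ : Matrix (Fin 3) (Fin 3) (UnitaryGroup.LocalRing L v)) ((Equiv.prodUnique (Fin 3) (Fin 1)).symm k).1 0) x), im (quadraticLocalEquiv L v (IsCMField.complexConj L) (complexConj_imagUnit L) (imagUnit_ne_zero L)).toLinearEquiv.toAddEquiv (hermForm (conjLocal L (IsCMField.complexConj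 L) v) ((localGram (↥(maximalRealSubfield L)) 3 (gram (↥(maximalRealSubfield L)) (Equiv.prodUnique (Fin 3) (Fin 1)) (realDiagonal L dV hdV) (TW (↥(maximalRealSubfield L)) ε)) v).map (toLocalRing L v)) (fun k => (T₀ : Matrix (Fin 3) (Fin 3) (UnitaryGroup.LocalRing L v)) ((Equiv.prodUnique (Fin 3) (Fin 1)).symm k).1 0) x)]
            (fun _ => a₀⁻¹ * re (quadraticLocalEquiv L v (IsCMField.complexConj L) (complexConj_imagUnit L) (imagUnit_ne_zero L)).toLinearEquiv.toAddEquiv (hermForm (conjLocal L (IsCMField.complexConj L) v) ((localGram (↥(maximalRealSubfield L)) 3 (gram (↥(maximalRealSubfield L)) (Equiv.prodUnique (Fin 3) (Fin 1)) (realDiagonal L dV hdV) (TW (↥(maximalRealSubfield L)) ε)) v).map (toLocalRing L v)) (fun k => (T₀ : Matrix (Fin 3) (Fin 3) (UnitaryGroup.LocalRing L v)) ((Equiv.prodUnique (Fin 3) (Fin 1)).symm k).1 1) x)),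
          Sum.elim ![im (quadraticLocalEquiv L v (IsCMField.complexConj L) (complexConj_imagUnit L) (imagUnit_ne_zero L)).toLinearEquiv.toAddEquiv (hermForm (conjLocal L (IsCMField.complexConj L) v) ((localGram (↥(maximalRealSubfield L)) 3 (gram (↥(maximalRealSubfield L)) (Equiv.prodUnique (Fin 3) (Fin 1)) (realDiagonal L dV hdV) (TW (↥(maximalRealSubfield L)) ε)) v).map (toLocalRing L v)) (fun k => ((u⁻¹ : (UnitaryGroup.LocalRing L v)ˣ) : UnitaryGroup.LocalRing L v) * (T₀ : Matrix (Fin 3) (Fin 3) (UnitaryGroup.LocalRing L v)) ((Equiv.prodUnique (Fin 3) (Fin 1)).symm k).1 2) x), -re (quadraticLocalEquiv L v (IsCMField.complexConj L) (complexConj_imagUnit L) (imagUnit_ne_zero L)).toLinearEquiv.toAddEquiv (hermForm (conjLocal L (IsCMField.complexConj L) v) ((localGram (↥(maximalRealSubfield L)) 3 (gram (↥(maximalRealSubfield L)) (Equiv.prodUnique (Fin 3) (Fin 1)) (realDiagonal L dV hdV) (TW (↥(maximalRealSubfield L)) ε)) v).map (toLocalRing L v)) (fun k => ((u⁻¹ :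 (UnitaryGroup.LocalRing L v)ˣ) : UnitaryGroup.LocalRing L v) * (T₀ : Matrix (Fin 3) (Fin 3) (UnitaryGroup.LocalRing L v)) ((Equiv.prodUnique (Fin 3) (Fin 1)).symm k).1 2) x)]
            (fun _ => im (quadraticLocalEquiv L v (IsCMField.complexConj L) (complexConj_imagUnit L) (imagUnit_ne_zero L)).toLinearEquiv.toAddEquiv (hermForm (conjLocal L (IsCMField.complexConj L) v) ((localGram (↥(maximalRealSubfield L)) 3 (gram (↥(maximalRealSubfield L)) (Equiv.prodUnique (Fin 3) (Fin 1)) (realDiagonal L dV hdV) (TW (↥(maximalRealSubfield L)) ε)) v).map (toLocalRing L v)) (fun k => (T₀ : Matrix (Fin 3) (Fin 3) (UnitaryGroup.LocalRing L v)) ((Equiv.prodUnique (Fin 3) (Fin 1)).symm k).1 1) x))))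
    -- (i-symplectic)
    (hib : ∀ w w' : (Fin 3 → (v.adicCompletion ↥(maximalRealSubfield L))) × (Fin 3 → (v.adicCompletion ↥(maximalRealSubfield L))), alt (polar (dotProductBilin (v.adicCompletion ↥(maximalRealSubfield L)) (v.adicCompletion ↥(maximalRealSubfield L)) (m := Fin 2 ⊕ Fin 1))) (Γ w) (Γ w') = alt (polar (localPairing (↥(maximalRealSubfield L)) 3 (gram (↥(maximalRealSubfield L)) (Equiv.prodUnique (Fin 3) (Fin 1)) (realDiagonal L dV hdV) (TW (↥(maximalRealSubfield L)) ε)) v)) w w')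
    -- (ii) `Ψ` intertwines along the coboundary of `Γ`
    (hii : ∀ (w : (Fin 3 → (v.adicCompletion ↥(maximalRealSubfield L))) × (Fin 3 → (v.adicCompletion ↥(maximalRealSubfield L)))) (t : (v.adicCompletion ↥(maximalRealSubfield L))) (f : SchwartzBruhat (Fin 3 → (v.adicCompletion ↥(maximalRealSubfield L)))),
        Ψ ((localSchrodinger (↥(maximalRealSubfield L)) 3 (gram (↥(maximalRealSubfield L)) (Equiv.prodUnique (Fin 3) (Fin 1)) (realDiagonal L dV hdV) (TW (↥(maximalRealSubfield L)) ε)) v) ⟨w, t⟩ f) = (schrodingerSB (dotProductBilin (v.adicCompletion ↥(maximalRealSubfield L)) (v.adicCompletion ↥(maximalRealSubfield L)) (m := Fin 2 ⊕ Fin 1)) (adeleAddCharAt (↥(maximalRealSubfield L)) v) (isLocallyConstant_of_isContinuousNontrivial (isContinuousNontrivial_adeleAddCharAt (↥(maximalRealSubfield L)) v)) (fun y => continuous_dotProductBilin_left y)) ⟨Γ w, t + ⅟(2 : (v.adicCompletion ↥(maximalRealSubfield L))) * ((polar (dotProductBilin (v.adicCompletion ↥(maximalRealSubfield L)) (v.adicCompletion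 ↥(maximalRealSubfield L)) (m := Fin 2 ⊕ Fin 1))) (Γ w) (Γ w) - (polar (localPairing (↥(maximalRealSubfield L)) 3 (gram (↥(maximalRealSubfield L)) (Equiv.prodUnique (Fin 3) (Fin 1)) (realDiagonal L dV hdV) (TW (↥(maximalRealSubfield L)) ε)) v)) w w)⟩ (Ψ f))
    -- (v) the fibre over `0`
    (hv : ∀ (f : SchwartzBruhat ((Fin 2 ⊕ Fin 1) → (v.adicCompletion ↥(maximalRealSubfield L)))) (u₀ : Fin 1 → (v.adicCompletion ↥(maximalRealSubfield L))),
        (φ₀ f : (Fin 1 → (v.adicCompletion ↥(maximalRealSubfield L))) → ℂ) u₀ = (f : ((Fin 2 ⊕ Fin 1) → (v.adicCompletion ↥(maximalRealSubfield L))) → ℂ) (Sum.elim 0 u₀)) :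
    ∃ (Γ₁ : ((Fin 1 → (v.adicCompletion ↥(maximalRealSubfield L))) × (Fin 1 → (v.adicCompletion ↥(maximalRealSubfield L)))) ≃ₗ[(v.adicCompletion ↥(maximalRealSubfield L))]
        ((Fin 1 → (v.adicCompletion ↥(maximalRealSubfield L))) × (Fin 1 → (v.adicCompletion ↥(maximalRealSubfield L)))))
      (Ψ₁ : SchwartzBruhat (Fin 1 → (v.adicCompletion ↥(maximalRealSubfield L))) ≃ₗ[ℂ] SchwartzBruhat (Fin 1 → (v.adicCompletion ↥(maximalRealSubfield L)))),
      (∀ w₁ : (Fin 1 → (v.adicCompletion ↥(maximalRealSubfield L))) × (Fin 1 → (v.adicCompletion ↥(maximalRealSubfield L))),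
        Γ (glue (finSumFinEquiv : Fin 1 ⊕ Fin 2 ≃ Fin 3) w₁.1 0, glue (finSumFinEquiv : Fin 1 ⊕ Fin 2 ≃ Fin 3) w₁.2 0) =
          (Sum.elim (0 : Fin 2 → (v.adicCompletion ↥(maximalRealSubfield L))) (Γ₁ w₁).1,
            Sum.elim (0 : Fin 2 → (v.adicCompletion ↥(maximalRealSubfield L))) (Γ₁ w₁).2)) ∧
      (∀ w₁ w₁' : (Fin 1 → (v.adicCompletion ↥(maximalRealSubfield L))) × (Fin 1 → (v.adicCompletion ↥(maximalRealSubfield L))),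
        alt (polar (dotProductBilin (v.adicCompletion ↥(maximalRealSubfield L)) (v.adicCompletion ↥(maximalRealSubfield L)) (m := Fin 1))) (Γ₁ w₁) (Γ₁ w₁') =
          alt (polar (localPairing (↥(maximalRealSubfield L)) 1 T₁ v)) w₁ w₁') ∧
      (∀ (w₁ : (Fin 1 → (v.adicCompletion ↥(maximalRealSubfield L))) × (Fin 1 → (v.adicCompletion ↥(maximalRealSubfield L)))) (t : (v.adicCompletion ↥(maximalRealSubfield L)))
          (f₁ : SchwartzBruhat (Fin 1 → (v.adicCompletion ↥(maximalRealSubfield L)))),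
        Ψ₁ (localSchrodinger (↥(maximalRealSubfield L)) 1 T₁ v ⟨w₁, t⟩ f₁) =
          schrodingerSB (dotProductBilin (v.adicCompletion ↥(maximalRealSubfield L)) (v.adicCompletion ↥(maximalRealSubfield L)) (m := Fin 1)) (adeleAddCharAt (↥(maximalRealSubfield L)) v)
            (isLocallyConstant_of_isContinuousNontrivial (isContinuousNontrivial_adeleAddCharAt (↥(maximalRealSubfield L)) v)) (fun y => continuous_dotProductBilin_left y)
            ⟨Γ₁ w₁, t + ⅟(2 : (v.adicCompletion ↥(maximalRealSubfield L))) * (polar (dotProductBilin (v.adicCompletion ↥(maximalRealSubfield L)) (v.adicCompletion ↥(maximalRealSubfield L)) (m := Fin 1)) (Γ₁ w₁) (Γ₁ w₁) -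
              polar (localPairing (↥(maximalRealSubfield L)) 1 T₁ v) w₁ w₁)⟩ (Ψ₁ f₁)) ∧
      ∀ f₂ : SchwartzBruhat (Fin 2 → (v.adicCompletion ↥(maximalRealSubfield L))), ∃ c : ℂ,
        ∀ f₁ : SchwartzBruhat (Fin 1 → (v.adicCompletion ↥(maximalRealSubfield L))),
          φ₀ (Ψ (boxSB (v.adicCompletion ↥(maximalRealSubfield L)) (finSumFinEquiv : Fin 1 ⊕ Fin 2 ≃ Fin 3) f₁ f₂)) = c • Ψ₁ f₁ := by
  classical
  -- the block structure of the local real Gram matrix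
  have hT : localGram (↥(maximalRealSubfield L)) 3 (gram (↥(maximalRealSubfield L)) (Equiv.prodUnique (Fin 3) (Fin 1)) (realDiagonal L dV hdV)
      (TW (↥(maximalRealSubfield L)) ε)) v = Matrix.reindex (finSumFinEquiv : Fin 1 ⊕ Fin 2 ≃ Fin 3) (finSumFinEquiv : Fin 1 ⊕ Fin 2 ≃ Fin 3)
        (Matrix.fromBlocks (localGram (↥(maximalRealSubfield L)) 1 T₁ v) 0 0 (localGram (↥(maximalRealSubfield L)) 2 T₂ v)) := by
    rw [hTsum]; exact BlockSum.localGram_finSum (↥(maximalRealSubfield L)) v 1 2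
  have hT₁' : IsUnit (localGram (↥(maximalRealSubfield L)) 1 T₁ v).det := isUnit_det_map _ hT₁
  -- the Gram matrix over `S` is diagonal: its column `0` vanishes off `0`
  have hH : ∀ k : Fin 3, k ≠ 0 → ((localGram (↥(maximalRealSubfield L)) 3 (gram (↥(maximalRealSubfield L)) (Equiv.prodUnique (Fin 3) (Fin 1))
      (realDiagonal L dV hdV) (TW (↥(maximalRealSubfield L)) ε)) v).map (toLocalRing L v)) k 0 = 0 := fun k hk => by
    rw [h0, Matrix.reindex_apply, Matrix.submatrix_apply, Equiv.prodUnique_symm_apply, Equiv.prodUnique_symm_apply, Matrix.kroneckerMap_apply,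
      Matrix.map_apply, Matrix.diagonal_apply_ne _ hk, map_zero, zero_mul]
  -- (C1) the chart sends the line summand into the `Fin 1`-slot
  have hsupp : ∀ w₁ : (Fin 1 → (v.adicCompletion ↥(maximalRealSubfield L))) × (Fin 1 → (v.adicCompletion ↥(maximalRealSubfield L))),
      (Γ (glue (finSumFinEquiv : Fin 1 ⊕ Fin 2 ≃ Fin 3) w₁.1 0, glue (finSumFinEquiv : Fin 1 ⊕ Fin 2 ≃ Fin 3) w₁.2 0)).1 ∘ Sum.inl = (0 : Fin 2 → (v.adicCompletion ↥(maximalRealSubfield L))) ∧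
      (Γ (glue (finSumFinEquiv : Fin 1 ⊕ Fin 2 ≃ Fin 3) w₁.1 0, glue (finSumFinEquiv : Fin 1 ⊕ Fin 2 ≃ Fin 3) w₁.2 0)).2 ∘ Sum.inl = (0 : Fin 2 → (v.adicCompletion ↥(maximalRealSubfield L))) := by
    intro w₁
    obtain ⟨xv, hxv⟩ : ∃ xv : Fin 3 → UnitaryGroup.LocalRing L v,
        xv = (reIm (quadraticLocalEquiv L v (IsCMField.complexConj L) (complexConj_imagUnit L) (imagUnit_ne_zero L)).toLinearEquiv.toAddEquiv (Fin 3)).symm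
          (glue (finSumFinEquiv : Fin 1 ⊕ Fin 2 ≃ Fin 3) w₁.1 0, glue (finSumFinEquiv : Fin 1 ⊕ Fin 2 ≃ Fin 3) w₁.2 0) := ⟨_, rfl⟩
    have hre : (glue (finSumFinEquiv : Fin 1 ⊕ Fin 2 ≃ Fin 3) w₁.1 0, glue (finSumFinEquiv : Fin 1 ⊕ Fin 2 ≃ Fin 3) w₁.2 0) =
        reIm (quadraticLocalEquiv L v (IsCMField.complexConj L) (complexConj_imagUnit L) (imagUnit_ne_zero L)).toLinearEquiv.toAddEquiv (Fin 3) xv := by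
      rw [hxv, AddEquiv.apply_symm_apply]
    -- `xv` is supported on the line coordinate `0 = finSumFinEquiv (inl 0)`
    have hxv0 : ∀ k : Fin 3, k ≠ 0 → xv k = 0 := by
      intro k hk
      obtain ⟨j, rfl⟩ : ∃ j : Fin 2, k = (finSumFinEquiv : Fin 1 ⊕ Fin 2 ≃ Fin 3) (Sum.inr j) := by
        rcases h : (finSumFinEquiv : Fin 1 ⊕ Fin 2 ≃ Fin 3).symm k with i | j
        · exact absurd ((Equiv.symm_apply_eq _).1 h) (by rw [Subsingleton.elim i 0]; exact hk)
        · exact ⟨j, ((Equiv.symm_apply_eq _).1 h)⟩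
      rw [hxv, reIm_symm_apply]
      dsimp only
      rw [glue_apply_inr, glue_apply_inr, Pi.zero_apply, Prod.mk_zero_zero, map_zero]
    have hX : hermForm (conjLocal L (IsCMField.complexConj L) v) ((localGram (↥(maximalRealSubfield L)) 3 (gram (↥(maximalRealSubfield L))
        (Equiv.prodUnique (Fin 3) (Fin 1)) (realDiagonal L dV hdV) (TW (↥(maximalRealSubfield L)) ε)) v).map (toLocalRing L v))
        (fun k => (T₀ : Matrix (Fin 3) (Fin 3) (UnitaryGroup.LocalRing L v)) ((Equiv.prodUnique (Fin 3) (Fin 1)).symm k).1 0) xv = 0 :=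
      hermForm_eq_zero_of_support _ _ _ _ 0 hxv0 hH (by rw [Equiv.prodUnique_symm_apply]; exact h00)
    have hY : hermForm (conjLocal L (IsCMField.complexConj L) v) ((localGram (↥(maximalRealSubfield L)) 3 (gram (↥(maximalRealSubfield L))
        (Equiv.prodUnique (Fin 3) (Fin 1)) (realDiagonal L dV hdV) (TW (↥(maximalRealSubfield L)) ε)) v).map (toLocalRing L v))
        (fun k => ((u⁻¹ : (UnitaryGroup.LocalRing L v)ˣ) : UnitaryGroup.LocalRing L v) *
          (T₀ : Matrix (Fin 3) (Fin 3) (UnitaryGroup.LocalRing L v)) ((Equiv.prodUnique (Fin 3) (Fin 1)).symm k).1 2) xv = 0 :=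
      hermForm_eq_zero_of_support _ _ _ _ 0 hxv0 hH (by rw [Equiv.prodUnique_symm_apply]; exact (congrArg _ h02).trans (mul_zero _))
    rw [hre, hi xv]
    dsimp only
    rw [hX, hY, Sum.elim_comp_inl, Sum.elim_comp_inl]
    simp only [map_zero, neg_zero]
    constructor <;> (funext i; fin_cases i <;> rfl)
  -- the generic factorisation
  obtain ⟨Γ₁, Ψ₁, hs, ha, hΨ₁, hc⟩ := exists_fibre_boxSB_eq_smul
    (isLocallyConstant_of_isContinuousNontrivial (isContinuousNontrivial_adeleAddCharAt (↥(maximalRealSubfield L)) v))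
    (finSumFinEquiv : Fin 1 ⊕ Fin 2 ≃ Fin 3) (localGram (↥(maximalRealSubfield L)) 1 T₁ v) (localGram (↥(maximalRealSubfield L)) 2 T₂ v) hT hT₁'
    (HeisenbergGroup.continuous_toLinearMap₂'_left (localGram (↥(maximalRealSubfield L)) 1 T₁ v))
    (HeisenbergGroup.continuous_toLinearMap₂'_left (localGram (↥(maximalRealSubfield L)) 3 (gram (↥(maximalRealSubfield L))
      (Equiv.prodUnique (Fin 3) (Fin 1)) (realDiagonal L dV hdV) (TW (↥(maximalRealSubfield L)) ε)) v))
    (fun y => continuous_dotProductBilin_left y) (fun y => continuous_dotProductBilin_left y) Γ hib hsupp (by simp) Ψ hii φ₀ hv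
    (isContinuousNontrivial_adeleAddCharAt (↥(maximalRealSubfield L)) v)
  exact ⟨Γ₁, Ψ₁, hs, ha, hΨ₁, hc⟩

end BlockFrame

end Summit.HodgeConjecture.HodgeConjecture.Cruxes.H413.F0P2oBlockFrameChartFactorisation

end
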